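import Summits.HodgeConjecture.HodgeConjecture.Theorems.Ring2HypothesesDescentAbsoluteRungs
import Summits.HodgeConjecture.HodgeConjecture.Theorems.Ring2HypothesesDescentMotivatedUpperHalf
import Literature.AlgebraicGeometry.HodgeTheory.AbsoluteHodgeClassesKunnethLefschetz
import HarnessLib

/-!
# Ring 2 — hypotheses layer, descent axis: row b06 IS ITS OWN LOWER HALF AND ITS OWN UPPER HALF (Deligne 1982, Ex. 2.1 (c))

HONEST FRAMING (page 1, verbatim the cell's standing line): **research route conditional on HC_CM; not a
corollary; Q11.4-sentence-2 already refuted in dim ≥ 3.** Nothing in this file proves a case of the Hodge conjecture;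
nothing discharges the binder of record b06 `Ring2.Hypotheses.AbsoluteHodgeImpliesAlgebraicAV` ("absolute Hodge classes
on complex abelian varieties are algebraic", `Ring2HypothesesDescent.lean` :73; OPEN, `≡ HC_AV` modulo Deligne's Main
Theorem 2.11 = fact c1); the binder table's numbers do not move. `HC_CM` (`Theses.RankFourFaces.CMAbelianHodge`) does not
occur in this file; `HC_AV` is not asserted.

Hodge ladder STAGE 3, `BINDER-OWNERS.md` row **b06**, seat `ring2-b06` (gen 68). THE ROW'S OWN RESIDUAL as recorded by
gens 54–58 of this seat: the ABSOLUTE twin of row b05's «row = its upper half» (`Ring2HypothesesDescentMotivatedUpperHalf`,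
ring2-b05 gen 33) could not be written because the tree had no stability of `IsAbsoluteHodgeClass` under André's `*_L`
("a NEW σ-fact (Deligne 1982 §2 stability of AH cycles)"); likewise gen 0's rung file (`Ring2HypothesesDescentAbsoluteRungs`,
`absoluteHodgeImpliesAlgebraicAV_of_deepMiddle`) had to phrase the deep-middle sufficiency with HODGE classes "to leave the
deep middle" by hard Lefschetz. That σ-fact is now a named fact of the tree (lane `lit-hodgefound`, 2026-08-21, count once
THEIRS): `deligne1982_lefschetz_absoluteHodge_iff` — **Deligne 1982, Example 2.1 (c)**: for a polarisation class `η` of the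
smooth projective `n`-fold `X`, `2p ≤ n`, `x ∈ H^{2p}(X(ℂ); ℂ)` is absolute Hodge iff `η^{n-2p} ∪ x` is — with its proved
`*_L` form `….lefschetzInvolution_iff`: **André's `*_L : H^{2p} → H^{2q}` (`p + q = n`) preserves and detects absolute Hodge
classes.** Everything below is MODULO THAT ONE NAMED FACT, displayed as the hypothesis
`(h21c : deligne1982_lefschetz_absoluteHodge_iff)`; the other tools are fact-free theorems of the tree (hard Lefschetz datum
`nonempty_hardLefschetzNFold_holds`; `Lʲ Nᵖ ⊆ N^{p+j}`, `HardLefschetzNFold.L_mem_algebraicClasses_of_mem`; Lieberman's `B(A)`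
in `*_L` form for EVERY complex abelian variety, `AbelianAll.standardConjectureBStar_abelianVariety`, and "algebraic
correspondences preserve algebraic classes", `AbelianAll.map_mem_algebraicClasses_of_isAlgebraicCorrespondence` — count once
the AbelianAll sub-cell's).

* §0 Bookkeeping: `Lʲ ∘ *_L`, `*_L ∘ *_L` with free target degrees; absolute Hodge classes of codimension `≤ 1` are
  algebraic on every smooth projective variety (Lefschetz `(1,1)`), and vanish above the dimension.
* §1 **TWO TRANSFERS on any smooth projective `X` of dimension `n`, `2p + j = n`, `q = p + j`**: (T↓)
  `absoluteHodge_algebraic_of_lower` — codimension `p` ⟹ codimension `q`: `*_L y ∈ H^{2p}` is absolute Hodge, hence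
  algebraic, and `y = Lʲ (*_L y)` — NO standard conjecture; (T↑) `absoluteHodge_algebraic_of_upper_of_isAlgebraicCorrespondence`
  — codimension `q` ⟹ codimension `p` granted the bidegree `(2q, 2p)` of `B(X)`: `x = *_L (*_L x)`.
* §2 **THE GENERAL ROW `AbsoluteHodgeImpliesAlgebraic` (all smooth projective varieties; Charles–Schnell 11.2.18) IS ITS
  LOWER HALF `2 ≤ p ≤ n/2`** (`absoluteHodgeImpliesAlgebraic_iff_lowerHalf`; per variety
  `forall_absoluteHodge_algebraic_of_lowerHalf`) — off abelian varieties no analogue of Main Theorem 2.11 is available, so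
  this is what (c) buys over c1.
* §3 **ROW b06 IS ITS LOWER HALF AND ITS UPPER HALF** (`absoluteHodgeImpliesAlgebraicAV_iff_lowerHalf`, `…_iff_upperHalf`);
  per abelian variety of dimension `g` the statement "absolute Hodge classes of codimension `p` are algebraic" DEPENDS ONLY
  ON `{p, g − p}` (`absoluteHodge_algebraic_abelian_iff_complement`); for `g ≤ 5` ONE codimension carries the row at `A` —
  `p = 2`, or equally `p = g − 2` — and row b06 up to dimension 5 ≡ "absolute Hodge classes in `H⁴` of abelian four- and
  fivefolds are algebraic". Contrast: row b05 (motivated classes) is halved by the tree to its UPPER half only; for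
  absolute Hodge classes Ex. 2.1 (c) is an `iff`, so both halves are available. Companion file
  `Ring2HypothesesDescentAbsoluteHalvingWords`: the same in the per-variety vocabulary `AbsoluteHodgeClassesAreAlgebraicFor`
  and the comparison of the moduli (c1 ⟹ the instance of (c) used here).

HONEST COLUMN. Nothing is discharged; row b06, the general row, `HC_AV` stay OPEN; (c) is a named fact (its printed proof
is Deligne's "canonical rational process", not in the tree), never asserted here. No reduction of row b06 to the MIDDLE
degree of even-dimensional abelian varieties is claimed (needs stability of absolute Hodge classes under exterior
products, absent); no numerical (hom ≡ num) form is claimed (needs Ex. 2.1 (a) and additivity of `IsAbsoluteHodgeClass`).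

References (bib keys): Deligne1982HodgeCycles (§2 Ex. 2.1 (c) p. 16, Main Thm. 2.11 p. 19), CharlesSchnell2014Notes
(Def. 11.2.3, §11.2.5 Conj. 11.2.18), Andre1996Motifs (§0.2–0.3 pp. 7–8, §1.1 p. 10), Lieberman1968 (main theorem),
Kleiman1968AlgebraicCycles (App. to §2, Thm. 2A11), VoisinHodgeI2002 (Thm. 6.25, Rem. 6.27, Thm. 11.30), VoisinHodgeII2003
(§9.2.4 Prop. 9.20–9.21), KerrPearlstein2011 (§3.1), MoonenZarhin1999 (Thm. 0.1). -/

noncomputable section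

set_option linter.dupNamespace false

open CategoryTheory AlgebraicGeometry
open Literature.AlgebraicTopology.SingularHomology Literature.Geometry.Kaehler
open Literature.AlgebraicGeometry Literature.AlgebraicGeometry.Motives
open Literature.AlgebraicGeometry.HodgeTheory
open Summit.HodgeConjecture.HodgeConjecture.Ring2.AbelianAll (standardConjectureBStar_abelianVariety
  map_mem_algebraicClasses_of_isAlgebraicCorrespondence)

namespace Summit.HodgeConjecture.HodgeConjecture.Ring2.Hypotheses

/-! ## §0 Bookkeeping: `*_L` against `Lʲ` with free target degrees; the fact-free ends of the codimension range -/

section Bookkeeping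

variable {X : SchemeOver ℂ} {η : complexBetti X 2} {d : ℕ}

/-- **`Lʲ ∘ *_L = id` above the middle, target degree free**: for `b + j = d`, `b + 2j = m` and `y ∈ Hᵐ(X(ℂ); ℂ)`,
`Lʲ (*_L y) = y` with `*_L : Hᵐ → Hᵇ` the inverse Lefschetz isomorphism and `Lʲ` in the explicit-target spelling
`lefschetzPowTo` (bookkeeping form of `lefschetzPow_lefschetzInvolution`). [cite: Andre1996Motifs, §0.2 (p. 7) and §1.1 (p. 10)] -/
theorem lefschetzPowTo_lefschetzInvolution (hL : HasHardLefschetzProperty η d) {b j m : ℕ} (hj : b + j = d)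
    (hm : b + 2 * j = m) (hab : m + b = 2 * d) (y : complexBetti X m) :
    lefschetzPowTo η j b m hm (lefschetzInvolution hL hab y) = y := by
  subst hm
  exact lefschetzPow_lefschetzInvolution hL hj hab y

/-- **`*_L ∘ *_L = id` from below the middle, target degree free**: for `a + j = d`, `a + 2j = b` and
`x ∈ Hᵃ(X(ℂ); ℂ)`, `*_L (*_L x) = x` (`*_L : Hᵃ → Hᵇ` is `Lʲ`, `*_L : Hᵇ → Hᵃ` its inverse; bookkeeping form of
`lefschetzInvolution_lefschetzInvolution_of_le`). [cite: Andre1996Motifs, §1.1 (p. 10)] -/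
theorem lefschetzInvolution_lefschetzInvolution_of_le_to (hL : HasHardLefschetzProperty η d) {a j b : ℕ}
    (hj : a + j = d) (hb : a + 2 * j = b) (hab : a + b = 2 * d) (hba : b + a = 2 * d) (x : complexBetti X a) :
    lefschetzInvolution hL hba (lefschetzInvolution hL hab x) = x := by
  subst hb
  exact lefschetzInvolution_lefschetzInvolution_of_le hL hj hab hba x

variable {n : ℕ}

/-- **Absolute Hodge classes of codimension `p ≤ 1` are algebraic on every smooth projective complex variety**
(fact-free: an absolute Hodge class is a rational `(p,p)` class, Charles–Schnell Def. 11.2.3 with `σ = id`; `p = 0` trivial,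
`p = 1` Lefschetz `(1,1)`, DISCHARGED in the tree as `lefschetzOneOne_rational_holds`). [cite: CharlesSchnell2014Notes, Def. 11.2.3]
[cite: VoisinHodgeI2002, Thm. 11.30] -/
theorem absoluteHodge_algebraic_of_codim_le_one (hX : IsSmoothProjective n X) {p : ℕ} (hp : p ≤ 1)
    (c : complexBetti X (2 * p)) (hc : IsAbsoluteHodgeClass n X p c) : c ∈ algebraicClasses X p :=
  hodgeClass_algebraic_of_codim_le_one hX hp c hc.isRationalClass hc.isOfHodgeType

/-- Above the dimension there is nothing to prove: for `n < p` an absolute Hodge class in `H^{2p}(X(ℂ); ℂ)` (of type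
`(p,p)` for the `n`-dimensional `X`) vanishes (`IsOfHodgeType.eq_zero_pp_of_lt`). [cite: CharlesSchnell2014Notes, Def. 11.2.3] -/
theorem absoluteHodge_algebraic_of_dim_lt {p : ℕ} (hp : n < p) (c : complexBetti X (2 * p))
    (hc : IsAbsoluteHodgeClass n X p c) : c ∈ algebraicClasses X p := by
  rw [hc.isOfHodgeType.eq_zero_pp_of_lt hp]
  exact Submodule.zero_mem _

end Bookkeeping

/-! ## §1 The two transfers on a smooth projective `n`-fold (modulo Deligne's Ex. 2.1 (c)) -/

section Transfer

variable {n : ℕ} {X : SchemeOver ℂ}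

/-- **TRANSFER (T↓): from codimension `p` UP TO codimension `q = p + j`, `2p + j = n` — no standard conjecture.** `X` smooth
projective of dimension `n` with a hard Lefschetz datum `Λ` (hyperplane class `[H]`); granted Deligne's Ex. 2.1 (c)
(`h21c`): if every absolute Hodge class of codimension `p` on `X` is algebraic, so is every absolute Hodge class `y` of
codimension `q`. Proof: `*_L y ∈ H^{2p}(X(ℂ); ℂ)` is absolute Hodge (`deligne1982_lefschetz_absoluteHodge_iff.lefschetzInvolution_iff`,
degrees `q + p = n`), hence algebraic; `Lʲ` maps `Nᵖ` into `N^{p+j}` (`[H] ∪ [Z] = [H · Z]`,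
`HardLefschetzNFold.L_mem_algebraicClasses_of_mem`) and `Lʲ (*_L y) = y`. [cite: Deligne1982HodgeCycles, §2 Example 2.1 (c) (p. 16)]
[cite: VoisinHodgeII2003, §9.2.4 Prop. 9.20] [cite: Andre1996Motifs, §1.1 (p. 10)] -/
theorem absoluteHodge_algebraic_of_lower (h21c : deligne1982_lefschetz_absoluteHodge_iff)
    (hX : IsSmoothProjective n X) (Λ : HardLefschetzNFold n X) {p j q : ℕ} (hj : 2 * p + j = n)
    (hq : p + j = q)
    (hlow : ∀ c : complexBetti X (2 * p), IsAbsoluteHodgeClass n X p c → c ∈ algebraicClasses X p)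
    (y : complexBetti X (2 * q)) (hy : IsAbsoluteHodgeClass n X q y) : y ∈ algebraicClasses X q := by
  subst hq
  have hab : 2 * (p + j) + 2 * p = 2 * n := by omega
  -- `*_L y ∈ H^{2p}` is absolute Hodge
  have hx : IsAbsoluteHodgeClass n X p (lefschetzInvolution Λ.hasHardLefschetz hab y) :=
    (h21c.lefschetzInvolution_iff hX Λ.isPolarizationClass (p := p + j) (q := p) (by omega) y).1 hy
  -- hence algebraic, and so is `Lʲ (*_L y) = y`
  have halg := Λ.L_mem_algebraicClasses_of_mem j p (by omega) (hlow _ hx)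
  rwa [HardLefschetzNFold.L, lefschetzPowTo_lefschetzInvolution Λ.hasHardLefschetz hj
    (show 2 * p + 2 * j = 2 * (p + j) by omega) hab y] at halg

/-- **TRANSFER (T↑): from codimension `q = p + j` DOWN TO codimension `p`, `2p + j = n`, given ONE algebraic bidegree of
`*_L`.** `X` smooth projective of dimension `n` with a hard Lefschetz datum `Λ`; granted Deligne's Ex. 2.1 (c) (`h21c`): if
André's `*_L : H^{2q}(X(ℂ); ℂ) → H^{2p}(X(ℂ); ℂ)` (the inverse of `Lʲ`) is induced by an algebraic correspondence — the
bidegree `(2q, 2p)` of `B(X)` — and every absolute Hodge class of codimension `q` is algebraic, so is every absolute Hodge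
class `x` of codimension `p`: `*_L x ∈ H^{2q}` is absolute Hodge (`….lefschetzInvolution_iff_of_le`), hence algebraic, and
`x = *_L (*_L x)` is algebraic because algebraic correspondences preserve algebraic classes (Voisin II Prop. 9.21; the
tree's fact-free `AbelianAll.map_mem_algebraicClasses_of_isAlgebraicCorrespondence`). The absolute twin of row b05's
`motivatedClasses_le_algebraicClasses_of_upper_of_isAlgebraicCorrespondence`. [cite: Deligne1982HodgeCycles, §2 Example 2.1 (c) (p. 16)]
[cite: VoisinHodgeII2003, §9.2.4 Prop. 9.21] [cite: Andre1996Motifs, §0.3 (pp. 7–8) and §1.1 (p. 10)] -/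
theorem absoluteHodge_algebraic_of_upper_of_isAlgebraicCorrespondence
    (h21c : deligne1982_lefschetz_absoluteHodge_iff) (hX : IsSmoothProjective n X) (Λ : HardLefschetzNFold n X)
    {p j q : ℕ} (hj : 2 * p + j = n) (hq : p + j = q) {hba : 2 * q + 2 * p = 2 * n}
    (hB : IsAlgebraicCorrespondence n n X X (lefschetzInvolution Λ.hasHardLefschetz hba))
    (hup : ∀ c : complexBetti X (2 * q), IsAbsoluteHodgeClass n X q c → c ∈ algebraicClasses X q)
    (x : complexBetti X (2 * p)) (hx : IsAbsoluteHodgeClass n X p x) : x ∈ algebraicClasses X p := by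
  subst hq
  have hab : 2 * p + 2 * (p + j) = 2 * n := by omega
  -- `*_L x ∈ H^{2(p+j)}` is absolute Hodge
  have hy : IsAbsoluteHodgeClass n X (p + j) (lefschetzInvolution Λ.hasHardLefschetz hab x) :=
    (h21c.lefschetzInvolution_iff_of_le hX Λ.isPolarizationClass (p := p) (q := p + j) (by omega)
      (by omega) x).1 hx
  -- hence algebraic, and so is `*_L (*_L x) = x`
  have h := map_mem_algebraicClasses_of_isAlgebraicCorrespondence hX hX hB (hup _ hy)
  rwa [lefschetzInvolution_lefschetzInvolution_of_le_to Λ.hasHardLefschetz hj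
    (show 2 * p + 2 * j = 2 * (p + j) by omega) hab hba x] at h

/-- **Under ONE bidegree of `B⋆(X, [H])` the two codimensions `p` and `q = n − p` carry the SAME statement** (modulo (c)):
for `2p + j = n`, `q = p + j`, and `*_L : H^{2q} → H^{2p}` an algebraic correspondence, "absolute Hodge classes of
codimension `p` on `X` are algebraic" iff "absolute Hodge classes of codimension `q` on `X` are algebraic" ((T↓) and (T↑)).
[cite: Deligne1982HodgeCycles, §2 Example 2.1 (c) (p. 16)] [cite: Andre1996Motifs, §0.3 (pp. 7–8)] -/
theorem absoluteHodge_algebraic_iff_complement_of_isAlgebraicCorrespondence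
    (h21c : deligne1982_lefschetz_absoluteHodge_iff) (hX : IsSmoothProjective n X) (Λ : HardLefschetzNFold n X)
    {p j q : ℕ} (hj : 2 * p + j = n) (hq : p + j = q) {hba : 2 * q + 2 * p = 2 * n}
    (hB : IsAlgebraicCorrespondence n n X X (lefschetzInvolution Λ.hasHardLefschetz hba)) :
    (∀ c : complexBetti X (2 * p), IsAbsoluteHodgeClass n X p c → c ∈ algebraicClasses X p) ↔
      ∀ c : complexBetti X (2 * q), IsAbsoluteHodgeClass n X q c → c ∈ algebraicClasses X q :=
  ⟨fun h ↦ absoluteHodge_algebraic_of_lower h21c hX Λ hj hq h,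
    fun h ↦ absoluteHodge_algebraic_of_upper_of_isAlgebraicCorrespondence h21c hX Λ hj hq hB h⟩

end Transfer

/-! ## §2 The general row `AbsoluteHodgeImpliesAlgebraic` is its lower half (modulo Deligne's Ex. 2.1 (c)) -/

section General

variable {n : ℕ} {X : SchemeOver ℂ}

/-- **Per variety: the LOWER HALF suffices.** `X` smooth projective of dimension `n`; granted (c): if the absolute Hodge
classes of codimension `p` with `2 ≤ p` and `2p ≤ n` are algebraic, ALL absolute Hodge classes on `X` are algebraic —
`p ≤ 1` by Lefschetz `(1,1)` (fact-free), `n < 2p ≤ 2n` by the transfer (T↓) from codimension `n − p` (hard Lefschetz datum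
`nonempty_hardLefschetzNFold_holds`), `p > n` empty. In the lane's words: Charles–Schnell's 11.2.18 for `X` is its
restriction to `2 ≤ p ≤ n/2`. [cite: Deligne1982HodgeCycles, §2 Example 2.1 (c) (p. 16)] [cite: VoisinHodgeI2002, Thm. 6.25 and Thm. 11.30]
[cite: CharlesSchnell2014Notes, §11.2.5 Conj. 11.2.18] -/
theorem forall_absoluteHodge_algebraic_of_lowerHalf (h21c : deligne1982_lefschetz_absoluteHodge_iff)
    (hX : IsSmoothProjective n X)
    (hlow : ∀ p : ℕ, 2 ≤ p → 2 * p ≤ n →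
      ∀ c : complexBetti X (2 * p), IsAbsoluteHodgeClass n X p c → c ∈ algebraicClasses X p)
    (p : ℕ) (c : complexBetti X (2 * p)) (hc : IsAbsoluteHodgeClass n X p c) : c ∈ algebraicClasses X p := by
  -- every codimension `l` with `2l ≤ n`
  have hle : ∀ l : ℕ, 2 * l ≤ n →
      ∀ c : complexBetti X (2 * l), IsAbsoluteHodgeClass n X l c → c ∈ algebraicClasses X l := by
    intro l hl c hc
    by_cases h1 : l ≤ 1
    · exact absoluteHodge_algebraic_of_codim_le_one hX h1 c hc
    · exact hlow l (by omega) hl c hc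
  by_cases hp : 2 * p ≤ n
  · exact hle p hp c hc
  by_cases hpn : p ≤ n
  · obtain ⟨Λ⟩ := nonempty_hardLefschetzNFold_holds n X hX
    exact absoluteHodge_algebraic_of_lower h21c hX Λ (p := n - p) (j := 2 * p - n) (q := p) (by omega)
      (by omega) (hle (n - p) (by omega)) c hc
  · exact absoluteHodge_algebraic_of_dim_lt (by omega) c hc

/-- **`AbsoluteHodgeImpliesAlgebraic` IS ITS LOWER HALF** (modulo (c)): "absolute Hodge classes are algebraic on every
smooth projective complex variety" (`Ring2HypothesesDescent`, OPEN) holds iff it holds in codimensions `2 ≤ p ≤ n/2`.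
Neither side is asserted. [cite: Deligne1982HodgeCycles, §2 Example 2.1 (c) (p. 16)] [cite: CharlesSchnell2014Notes, §11.2.5 Conj. 11.2.18] -/
theorem absoluteHodgeImpliesAlgebraic_iff_lowerHalf (h21c : deligne1982_lefschetz_absoluteHodge_iff) :
    AbsoluteHodgeImpliesAlgebraic ↔
      ∀ ⦃n : ℕ⦄ ⦃X : SchemeOver ℂ⦄, IsSmoothProjective n X → ∀ p : ℕ, 2 ≤ p → 2 * p ≤ n →
        ∀ c : complexBetti X (2 * p), IsAbsoluteHodgeClass n X p c → c ∈ algebraicClasses X p :=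
  ⟨fun h _ _ hX p _ _ c hc ↦ h hX p c hc,
    fun h _ _ hX p c hc ↦ forall_absoluteHodge_algebraic_of_lowerHalf h21c hX (h hX) p c hc⟩

/-- **Low dimension, any variety** (modulo (c)): on a smooth projective `X` of dimension `n ≤ 3` every absolute Hodge class
is algebraic — the lower half `2 ≤ p ≤ n/2` is empty. (Fact-free through the Hodge conjecture for `n ≤ 3`,
`hodgeClasses_algebraic_of_dim_le_three_holds`; recorded here as the degenerate case of the halving.)
[cite: VoisinHodgeII2003, §10.2.3 proof of Prop. 10.26] [cite: CharlesSchnell2014Notes, Def. 11.2.3] -/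
theorem absoluteHodge_algebraic_of_dim_le_three (hX : IsSmoothProjective n X) (hn : n ≤ 3) (p : ℕ)
    (c : complexBetti X (2 * p)) (hc : IsAbsoluteHodgeClass n X p c) : c ∈ algebraicClasses X p :=
  hodgeClasses_algebraic_of_dim_le_three_holds hn hX p c hc.isRationalClass hc.isOfHodgeType

end General

/-! ## §3 Abelian varieties: Lieberman's `B(A)` gives both transfers — row b06 is its lower half and its upper half -/

section Abelian

/-- **(T↓) on a complex abelian variety** (modulo (c)): for `2p + j = dim A`, `q = p + j`, if the absolute Hodge classes of
codimension `p` on `A` are algebraic, so are those of codimension `q`. [cite: Deligne1982HodgeCycles, §2 Example 2.1 (c) (p. 16)]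
[cite: VoisinHodgeII2003, §9.2.4 Prop. 9.20] -/
theorem absoluteHodge_algebraic_abelian_of_lower (h21c : deligne1982_lefschetz_absoluteHodge_iff)
    (A : AbelianVariety ℂ) {p j q : ℕ} (hj : 2 * p + j = A.dim) (hq : p + j = q)
    (hlow : ∀ c : complexBetti A.X (2 * p), IsAbsoluteHodgeClass A.dim A.X p c → c ∈ algebraicClasses A.X p)
    (y : complexBetti A.X (2 * q)) (hy : IsAbsoluteHodgeClass A.dim A.X q y) : y ∈ algebraicClasses A.X q := by
  have hA : IsSmoothProjective A.dim A.X := AbelianVariety.isSmoothProjective_holds (A := A)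
  obtain ⟨Λ⟩ := nonempty_hardLefschetzNFold_holds A.dim A.X hA
  exact absoluteHodge_algebraic_of_lower h21c hA Λ hj hq hlow y hy

/-- **(T↑) on a complex abelian variety, UNCONDITIONALLY in `B`** (modulo (c)): for `2p + j = dim A`, `q = p + j`, if the
absolute Hodge classes of codimension `q` on `A` are algebraic, so are those of codimension `p` — `*_L : H^{2q} → H^{2p}` is
an algebraic correspondence by Lieberman's theorem (Kleiman Thm. 2A11; the AbelianAll sub-cell's fact-free
`standardConjectureBStar_abelianVariety`). [cite: Lieberman1968, main theorem] [cite: Kleiman1968AlgebraicCycles, Appendix to §2, Thm. 2A11]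
[cite: Deligne1982HodgeCycles, §2 Example 2.1 (c) (p. 16)] -/
theorem absoluteHodge_algebraic_abelian_of_upper (h21c : deligne1982_lefschetz_absoluteHodge_iff)
    (A : AbelianVariety ℂ) {p j q : ℕ} (hj : 2 * p + j = A.dim) (hq : p + j = q)
    (hup : ∀ c : complexBetti A.X (2 * q), IsAbsoluteHodgeClass A.dim A.X q c → c ∈ algebraicClasses A.X q)
    (x : complexBetti A.X (2 * p)) (hx : IsAbsoluteHodgeClass A.dim A.X p x) : x ∈ algebraicClasses A.X p := by
  have hA : IsSmoothProjective A.dim A.X := AbelianVariety.isSmoothProjective_holds (A := A)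
  obtain ⟨Λ⟩ := nonempty_hardLefschetzNFold_holds A.dim A.X hA
  exact absoluteHodge_algebraic_of_upper_of_isAlgebraicCorrespondence h21c hA Λ hj hq
    (hba := by omega)
    (standardConjectureBStar_abelianVariety A Λ.hyperplaneClass Λ.isPolarizationClass _ _ _) hup x hx

/-- **On a complex abelian variety of dimension `g`, "the absolute Hodge classes of codimension `p` are algebraic" depends
only on the unordered pair `{p, g − p}`** (modulo (c)): for `p + q = g` the statements in codimension `p` and in
codimension `q` are EQUIVALENT ((T↓) one way, (T↑) with Lieberman the other). Neither is asserted.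
[cite: Deligne1982HodgeCycles, §2 Example 2.1 (c) (p. 16)] [cite: Lieberman1968, main theorem] -/
theorem absoluteHodge_algebraic_abelian_iff_complement (h21c : deligne1982_lefschetz_absoluteHodge_iff)
    (A : AbelianVariety ℂ) {p q : ℕ} (hpq : p + q = A.dim) :
    (∀ c : complexBetti A.X (2 * p), IsAbsoluteHodgeClass A.dim A.X p c → c ∈ algebraicClasses A.X p) ↔
      ∀ c : complexBetti A.X (2 * q), IsAbsoluteHodgeClass A.dim A.X q c → c ∈ algebraicClasses A.X q := by
  rcases Nat.le_total p q with hle | hle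
  · -- `2p ≤ g`: `q = p + (q - p)`
    exact ⟨fun h ↦ absoluteHodge_algebraic_abelian_of_lower h21c A (j := q - p) (by omega) (by omega) h,
      fun h ↦ absoluteHodge_algebraic_abelian_of_upper h21c A (j := q - p) (by omega) (by omega) h⟩
  · -- `2q ≤ g`: `p = q + (p - q)`
    exact ⟨fun h ↦ absoluteHodge_algebraic_abelian_of_upper h21c A (j := p - q) (by omega) (by omega) h,
      fun h ↦ absoluteHodge_algebraic_abelian_of_lower h21c A (j := p - q) (by omega) (by omega) h⟩

/-- **Per abelian variety: the LOWER HALF suffices** (modulo (c)) — if the absolute Hodge classes of codimension `p` with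
`2 ≤ p`, `2p ≤ dim A` (cycle dimension `≥ dim A / 2`) are algebraic, all absolute Hodge classes on `A` are (§2 for `X = A`).
[cite: Deligne1982HodgeCycles, §2 Example 2.1 (c) (p. 16)] [cite: VoisinHodgeI2002, Thm. 6.25 and Thm. 11.30] -/
theorem forall_absoluteHodge_algebraic_abelian_of_lowerHalf (h21c : deligne1982_lefschetz_absoluteHodge_iff)
    (A : AbelianVariety ℂ)
    (hlow : ∀ p : ℕ, 2 ≤ p → 2 * p ≤ A.dim →
      ∀ c : complexBetti A.X (2 * p), IsAbsoluteHodgeClass A.dim A.X p c → c ∈ algebraicClasses A.X p)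
    (p : ℕ) (c : complexBetti A.X (2 * p)) (hc : IsAbsoluteHodgeClass A.dim A.X p c) :
    c ∈ algebraicClasses A.X p :=
  forall_absoluteHodge_algebraic_of_lowerHalf h21c (AbelianVariety.isSmoothProjective_holds (A := A)) hlow p c hc

/-- **Per abelian variety: the UPPER HALF suffices** (modulo (c); Lieberman) — if the absolute Hodge classes of codimension
`p` with `dim A ≤ 2p ≤ 2 dim A − 4` (cycle dimension `2 ≤ dim A − p ≤ dim A / 2`) are algebraic, all absolute Hodge classes
on `A` are: corners `p ≤ 1`, `p + 1 ≥ dim A` fact-free (RUNG b06-r1, `absoluteHodge_algebraic_abelian_of_corner`), and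
`2 ≤ p < dim A / 2` by (T↑) from codimension `dim A − p`. The absolute twin of row b05's
`forall_motivatedClasses_le_algebraicClasses_abelianVariety_of_upperHalf`. [cite: Deligne1982HodgeCycles, §2 Example 2.1 (c) (p. 16)]
[cite: Lieberman1968, main theorem] [cite: VoisinHodgeI2002, Thm. 6.25 and Thm. 11.30] -/
theorem forall_absoluteHodge_algebraic_abelian_of_upperHalf (h21c : deligne1982_lefschetz_absoluteHodge_iff)
    (A : AbelianVariety ℂ)
    (hup : ∀ p : ℕ, A.dim ≤ 2 * p → p + 2 ≤ A.dim →
      ∀ c : complexBetti A.X (2 * p), IsAbsoluteHodgeClass A.dim A.X p c → c ∈ algebraicClasses A.X p)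
    (p : ℕ) (c : complexBetti A.X (2 * p)) (hc : IsAbsoluteHodgeClass A.dim A.X p c) :
    c ∈ algebraicClasses A.X p := by
  by_cases hcorner : p ≤ 1 ∨ A.dim ≤ p + 1
  · exact absoluteHodge_algebraic_abelian_of_corner A hcorner c hc
  by_cases h2 : A.dim ≤ 2 * p
  · exact hup p h2 (by omega) c hc
  · -- `2 ≤ p`, `2p < dim A`: transfer down from `q = dim A - p` (upper half)
    exact absoluteHodge_algebraic_abelian_of_upper h21c A (j := A.dim - 2 * p) (q := A.dim - p)
      (by omega) (by omega) (hup (A.dim - p) (by omega) (by omega)) c hc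

/-- **ROW b06 IS ITS LOWER HALF** (modulo Deligne's Ex. 2.1 (c)): `AbsoluteHodgeImpliesAlgebraicAV` holds iff on every
complex abelian variety every absolute Hodge class of codimension `2 ≤ p ≤ dim A / 2` is algebraic. The INTRINSIC form of
the rung file's `absoluteHodgeImpliesAlgebraicAV_iff_deepMiddle_of_deligne` (there: Hodge classes, modulo Main Theorem
2.11). Row b06 is NOT asserted. [cite: Deligne1982HodgeCycles, §2 Example 2.1 (c) (p. 16)] [cite: KerrPearlstein2011, §3.1] -/
theorem absoluteHodgeImpliesAlgebraicAV_iff_lowerHalf (h21c : deligne1982_lefschetz_absoluteHodge_iff) :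
    AbsoluteHodgeImpliesAlgebraicAV ↔
      ∀ (A : AbelianVariety ℂ) (p : ℕ), 2 ≤ p → 2 * p ≤ A.dim →
        ∀ c : complexBetti A.X (2 * p), IsAbsoluteHodgeClass A.dim A.X p c → c ∈ algebraicClasses A.X p :=
  ⟨fun h A p _ _ c hc ↦ h A p c hc,
    fun h A p c hc ↦ forall_absoluteHodge_algebraic_abelian_of_lowerHalf h21c A (h A) p c hc⟩

/-- **ROW b06 IS ITS UPPER HALF** (modulo Deligne's Ex. 2.1 (c); Lieberman): `AbsoluteHodgeImpliesAlgebraicAV` holds iff on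
every complex abelian variety every absolute Hodge class of codimension `p` with `dim A ≤ 2p ≤ 2 dim A − 4` — cycle
dimension `2 ≤ dim A − p ≤ dim A / 2` — is algebraic. The absolute twin of row b05's `motivatedImpliesAlgebraicAV_iff_upperHalf`.
Row b06 is NOT asserted. [cite: Deligne1982HodgeCycles, §2 Example 2.1 (c) (p. 16)] [cite: Lieberman1968, main theorem] -/
theorem absoluteHodgeImpliesAlgebraicAV_iff_upperHalf (h21c : deligne1982_lefschetz_absoluteHodge_iff) :
    AbsoluteHodgeImpliesAlgebraicAV ↔
      ∀ (A : AbelianVariety ℂ) (p : ℕ), A.dim ≤ 2 * p → p + 2 ≤ A.dim →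
        ∀ c : complexBetti A.X (2 * p), IsAbsoluteHodgeClass A.dim A.X p c → c ∈ algebraicClasses A.X p :=
  ⟨fun h A p _ _ c hc ↦ h A p c hc,
    fun h A p c hc ↦ forall_absoluteHodge_algebraic_abelian_of_upperHalf h21c A (h A) p c hc⟩

/-- **Dimension `≤ 5`: CODIMENSION 2 carries row b06 at `A`** (modulo (c)): on a complex abelian variety of dimension `≤ 5`,
if the absolute Hodge classes in `H⁴(A(ℂ); ℂ)` are algebraic then all absolute Hodge classes on `A` are (the lower half
`2 ≤ p ≤ dim A / 2` is `{2}` for `dim A = 4, 5` and empty below). The hypothesis is NOT asserted.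
[cite: Deligne1982HodgeCycles, §2 Example 2.1 (c) (p. 16)] [cite: VoisinHodgeI2002, Thm. 6.25 and Thm. 11.30] -/
theorem forall_absoluteHodge_algebraic_abelian_of_dim_le_five_of_codim_two
    (h21c : deligne1982_lefschetz_absoluteHodge_iff) (A : AbelianVariety ℂ) (h5 : A.dim ≤ 5)
    (h2 : ∀ c : complexBetti A.X (2 * 2), IsAbsoluteHodgeClass A.dim A.X 2 c → c ∈ algebraicClasses A.X 2)
    (p : ℕ) (c : complexBetti A.X (2 * p)) (hc : IsAbsoluteHodgeClass A.dim A.X p c) :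
    c ∈ algebraicClasses A.X p := by
  refine forall_absoluteHodge_algebraic_abelian_of_lowerHalf h21c A (fun q hq hq2 ↦ ?_) p c hc
  obtain rfl : q = 2 := by omega
  exact h2

/-- **Dimension `≤ 5`: equally, CODIMENSION `dim A − 2` (absolute Hodge classes of 2-CYCLES) carries row b06 at `A`**
(modulo (c); Lieberman): the upper half `dim A ≤ 2p ≤ 2 dim A − 4` is `{dim A − 2}` for `dim A = 4, 5`. The absolute twin of
row b05's `forall_motivatedClasses_le_algebraicClasses_abelianVariety_of_dim_le_five`. The hypothesis is NOT asserted.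
[cite: Deligne1982HodgeCycles, §2 Example 2.1 (c) (p. 16)] [cite: Lieberman1968, main theorem] -/
theorem forall_absoluteHodge_algebraic_abelian_of_dim_le_five_of_codim_dim_sub_two
    (h21c : deligne1982_lefschetz_absoluteHodge_iff) (A : AbelianVariety ℂ) (h5 : A.dim ≤ 5)
    (h : ∀ c : complexBetti A.X (2 * (A.dim - 2)), IsAbsoluteHodgeClass A.dim A.X (A.dim - 2) c →
      c ∈ algebraicClasses A.X (A.dim - 2))
    (p : ℕ) (c : complexBetti A.X (2 * p)) (hc : IsAbsoluteHodgeClass A.dim A.X p c) :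
    c ∈ algebraicClasses A.X p := by
  refine forall_absoluteHodge_algebraic_abelian_of_upperHalf h21c A (fun q hq hq2 ↦ ?_) p c hc
  obtain rfl : q = A.dim - 2 := by omega
  exact h

/-- **Row b06 up to dimension 5 ≡ absolute Hodge classes in `H⁴` of abelian FOUR- and FIVEFOLDS are algebraic** (modulo
(c)): the restriction of `AbsoluteHodgeImpliesAlgebraicAV` to `dim A ≤ 5` holds iff every absolute Hodge class of
codimension 2 on every complex abelian variety of dimension `4` or `5` is algebraic (dimension `≤ 3` is fact-free, RUNG
b06-r2). Compare RUNG b06-r4 (the same restriction modulo Moonen–Zarhin 1999 and the Weil classes of abelian fourfolds).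
Neither side is asserted. [cite: Deligne1982HodgeCycles, §2 Example 2.1 (c) (p. 16)] [cite: MoonenZarhin1999, Thm. 0.1] -/
theorem absoluteHodgeImpliesAlgebraicAV_dim_le_five_iff_codim_two_of_dim_four_five
    (h21c : deligne1982_lefschetz_absoluteHodge_iff) :
    (∀ (A : AbelianVariety ℂ), A.dim ≤ 5 → ∀ (p : ℕ) (c : complexBetti A.X (2 * p)),
        IsAbsoluteHodgeClass A.dim A.X p c → c ∈ algebraicClasses A.X p) ↔
      ∀ (A : AbelianVariety ℂ), 4 ≤ A.dim → A.dim ≤ 5 → ∀ c : complexBetti A.X (2 * 2),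
        IsAbsoluteHodgeClass A.dim A.X 2 c → c ∈ algebraicClasses A.X 2 := by
  refine ⟨fun h A _ h5 c hc ↦ h A h5 2 c hc, fun h A h5 p c hc ↦ ?_⟩
  by_cases h3 : A.dim ≤ 3
  · exact absoluteHodge_algebraic_abelian_of_dim_le_three A h3 p c hc
  · exact forall_absoluteHodge_algebraic_abelian_of_dim_le_five_of_codim_two h21c A h5
      (h A (by omega) h5) p c hc

end Abelian

/-! ## Audit: nothing is decided here

No theorem above concludes `AbsoluteHodgeImpliesAlgebraicAV`, `AbsoluteHodgeImpliesAlgebraic`, `HC_AV` or `HC_CM`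
outright: every statement is an equivalence between OPEN statements, an implication with an undischarged hypothesis
(`hlow`, `hup`, `h2`, `h`), or a fact-free corner; the named fact (c) `deligne1982_lefschetz_absoluteHodge_iff` occurs only
as a hypothesis. Axiom closures: the three standard axioms. -/

#print axioms Summit.HodgeConjecture.HodgeConjecture.Ring2.Hypotheses.absoluteHodge_algebraic_of_lower
#print axioms Summit.HodgeConjecture.HodgeConjecture.Ring2.Hypotheses.absoluteHodgeImpliesAlgebraic_iff_lowerHalf
#print axioms Summit.HodgeConjecture.HodgeConjecture.Ring2.Hypotheses.absoluteHodgeImpliesAlgebraicAV_iff_lowerHalf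
#print axioms Summit.HodgeConjecture.HodgeConjecture.Ring2.Hypotheses.absoluteHodgeImpliesAlgebraicAV_iff_upperHalf
#print axioms Summit.HodgeConjecture.HodgeConjecture.Ring2.Hypotheses.absoluteHodge_algebraic_abelian_iff_complement

end Summit.HodgeConjecture.HodgeConjecture.Ring2.Hypotheses

end
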